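import Literature.Analysis.FluidPDE.NSRobustnessOfRegularityH2Smoothing
import HarnessLib

/-!
# Robustness of regularity on `ℝ³`, smoothing vein IV: the `H¹ → H²` smoothing letter on an
# arbitrary window `[t₀, t₁]` (the shape a windowed certificate checks)

Analysis/FluidPDE proof file (theorems only; no definitions, no named facts, no `sorry`); seventh
file of the vein `NSRobustnessOfRegularity` → `…H2` → `…SupNorm` → `…HalfFlux` → `…Dissipation` →
`…H2Smoothing`. The smoothing theorem `classicalNS_H2_smoothing_strain_R3` and its Agmon readout are
transported from `[0, T]` to `[t₀, t₁]` by the time translation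
`IsClassicalNSSolutionOn.comp_add_right` (exactly as `classicalNS_robustness_H2_strain_window_R3`
transports the `H²` letter): the conclusion holds on the SECOND HALF `[(t₀ + t₁)/2, t₁]`.

* `classicalNS_H2_smoothing_strain_window_R3` — with `h = t₁ − t₀`, `D ≥ X₁(t₀) + ∫_{t₀}^{t₁} φ`,
  `Ψ₂ ≥ ∫_{t₀}^{t₁} ψ`, `η = 2D/(νh) + Ψ₂`, `β = A²μ/ν`: if `βe^{∫_{t₀}^{t₁} l}ηh < 1` then
  `Z(t) ≤ e^{∫_{t₀}^{t} l}η/(1 − βe^{∫_{t₀}^{t₁} l}ηh)` for `t ∈ [(t₀ + t₁)/2, t₁]`.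
* `classicalNS_norm_sub_le_H2_smoothing_window_R3` — the Agmon readout on the same half window:
  `‖v(t,x) − u(t,x)‖ ≤ A(3X₁(t)·e^{∫_{t₀}^{t} l}η/(1 − βe^{∫_{t₀}^{t₁} l}ηh))^{1/4}`.
* `classicalNS_H2_smoothing_strain_window_half_R3` — closed form under half-smallness:
  `Z(t) ≤ 2e^{∫_{t₀}^{t} l}η` (the readable price: fee `e^{∫l}` over ONE window, the `H¹` budget
  weighted by `2/(νh)`).

WHAT THIS IS NOT: not a statement about Navier–Stokes regularity or blow-up — a-priori calculus
between two GIVEN classical solutions; the existence half is not here. Consumer: cell `ns-blowup`,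
crux 20303 `EpisodeBaseT`, hybrid strain door on the terminal window `[W − 1/A₁, W]`.

## Mathlib / tree search

Tree: `classicalNS_H2_smoothing_strain_R3`, `classicalNS_norm_sub_le_H2_smoothing_R3`,
`IsClassicalNSSolutionOn.comp_add_right`, `timeDerivWithin_comp_add_right`. Mathlib:
`intervalIntegral.integral_comp_add_right`, `Set.preimage_add_const_Icc`.

## References

* P. Constantin, C. Foias, *Navier–Stokes Equations*, Univ. Chicago Press 1988, Ch. 10.
  [ConstantinFoias1988]
* M. Dashti, J. C. Robinson, SIAM J. Numer. Anal. 46 (2008) 3136–3150, Thm 2. [DashtiRobinson2008]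
* J. C. Robinson, J. L. Rodrigo, W. Sadowski, *The Three-Dimensional Navier–Stokes Equations*,
  CUP 2016, Thm 1.20, Thm 6.8, Thm 9.1. [RobinsonRodrigoSadowskiCUP2016]
-/

noncomputable section

open MeasureTheory Set Function Filter Topology InnerProductSpace
open scoped ENNReal NNReal ContDiff RealInnerProductSpace Laplacian

namespace Literature.Analysis.FluidPDE

section WindowSmoothing

variable {ν t₀ t₁ : ℝ} {f g u v : ℝ → EuclideanSpace ℝ (Fin 3) → EuclideanSpace ℝ (Fin 3)}
variable {p q : ℝ → EuclideanSpace ℝ (Fin 3) → ℝ}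

/-- Slicewise Sobolev bounds translate in time (copy of the vein's private lemma). [folklore] -/
private theorem h2s_bounds_comp_add {G' : Type*} [NormedAddCommGroup G'] [NormedSpace ℝ G']
    {w : ℝ → EuclideanSpace ℝ (Fin 3) → G'} {a b s : ℝ}
    (h : ∀ n : ℕ, ∃ C : ℝ≥0, ∀ t ∈ Icc (a + s) (b + s), ∫⁻ x, ‖iteratedFDeriv ℝ n (w t) x‖ₑ ^ 2 ≤ C) :
    ∀ n : ℕ, ∃ C : ℝ≥0, ∀ t ∈ Icc a b, ∫⁻ x, ‖iteratedFDeriv ℝ n (w (t + s)) x‖ₑ ^ 2 ≤ C :=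
  fun n => (h n).imp fun _ hC t ht => hC (t + s) ⟨by linarith [ht.1], by linarith [ht.2]⟩

/-- **`H¹ → H²` smoothing of the difference of two classical solutions on an arbitrary window
`[t₀, t₁]`, strain form, a priori** (`classicalNS_H2_smoothing_strain_R3` after the time translation
`IsClassicalNSSolutionOn.comp_add_right`): class hypotheses on `[t₀, t₁]` (`t₀ < t₁`, `h = t₁ − t₀`),
continuous majorants `G, σ₂, σ₃, L, X₁, H₀, H₁, ψ` there, free lengths `κ, μ > 0`, dissipation
budget `D ≥ X₁(t₀) + ∫_{t₀}^{t₁} φ` (`φ = (4G + 3κσ₂)X₁ + 4A⁴X₁³/ν³ + 4H₀/ν + 3σ₂L²/κ`),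
`Ψ₂ ≥ ∫_{t₀}^{t₁} ψ` (`ψ ≥ 27σ₂X₁/κ + 9σ₃L²/κ² + 6H₁/ν`), rate
`l = 6G + 9κσ₂ + 3κ²σ₃ + 3A²X₁/(νμ) + 27A⁴X₁²/(16ν³)`, `β = A²μ/ν`, `η = 2D/(νh) + Ψ₂`: if
`βe^{∫_{t₀}^{t₁} l}ηh < 1` then `Σᵢ∫|∇∂ᵢ(v − u)(t)|²_F ≤ e^{∫_{t₀}^{t} l}η/(1 − βe^{∫_{t₀}^{t₁} l}ηh)`
for every `t ∈ [(t₀ + t₁)/2, t₁]` — no hypothesis on the `H²` defect at `t₀`.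
[cite: ConstantinFoias1988, Ch. 10 (proof of Thm 10.6); DashtiRobinson2008, Thm 2] -/
theorem classicalNS_H2_smoothing_strain_window_R3 (hν : 0 < ν) (ht₀₁ : t₀ < t₁)
    (hv : IsClassicalNSSolutionOn (Icc t₀ t₁) ν g v q)
    (hu : IsClassicalNSSolutionOn (Icc t₀ t₁) ν f u p)
    (hU : HasBoundedSobolevNormsOn (Icc t₀ t₁) u)
    (hUt : HasBoundedSobolevNormsOn (Icc t₀ t₁) (timeDerivWithin (Icc t₀ t₁) u))
    (hp : ∀ n : ℕ, ∃ C : ℝ≥0, ∀ t ∈ Icc t₀ t₁, ∫⁻ x, ‖iteratedFDeriv ℝ n (p t) x‖ₑ ^ 2 ≤ C)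
    (hV : HasBoundedSobolevNormsOn (Icc t₀ t₁) v)
    (hVt : HasBoundedSobolevNormsOn (Icc t₀ t₁) (timeDerivWithin (Icc t₀ t₁) v))
    (hq : ∀ n : ℕ, ∃ C : ℝ≥0, ∀ t ∈ Icc t₀ t₁, ∫⁻ x, ‖iteratedFDeriv ℝ n (q t) x‖ₑ ^ 2 ≤ C)
    {G σ₂ σ₃ L X₁ H₀ H₁ ψ : ℝ → ℝ} {κ μ D Ψ₂ : ℝ} (hκ : 0 < κ) (hμ : 0 < μ)
    (hG : ∀ s ∈ Icc t₀ t₁, ∀ (x ξ : EuclideanSpace ℝ (Fin 3)),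
      -⟪fderiv ℝ (u s) x ξ, ξ⟫ ≤ G s * ‖ξ‖ ^ 2)
    (hσ₂ : ∀ s ∈ Icc t₀ t₁, ∀ x, ‖iteratedFDeriv ℝ 2 (u s) x‖ ≤ σ₂ s)
    (hσ₃ : ∀ s ∈ Icc t₀ t₁, ∀ x, ‖iteratedFDeriv ℝ 3 (u s) x‖ ≤ σ₃ s)
    (hL : ∀ s ∈ Icc t₀ t₁, Real.sqrt (∫ x, ‖(v - u) s x‖ ^ 2) ≤ L s)
    (hX₁ : ∀ s ∈ Icc t₀ t₁, ∫ x, frobeniusNormSq (fderiv ℝ ((v - u) s) x) ≤ X₁ s)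
    (hH₀ : ∀ s ∈ Icc t₀ t₁, ∫ x, ‖f s x - g s x‖ ^ 2 ≤ H₀ s)
    (hH₁ : ∀ s ∈ Icc t₀ t₁, ∫ x, ‖fderiv ℝ (fun y => f s y - g s y) x‖ ^ 2 ≤ H₁ s)
    (hψ : ∀ s ∈ Icc t₀ t₁,
      27 * σ₂ s / κ * X₁ s + 9 * σ₃ s / κ ^ 2 * L s ^ 2 + 6 / ν * H₁ s ≤ ψ s)
    (hGc : ContinuousOn G (Icc t₀ t₁)) (hσ₂c : ContinuousOn σ₂ (Icc t₀ t₁))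
    (hσ₃c : ContinuousOn σ₃ (Icc t₀ t₁)) (hLc : ContinuousOn L (Icc t₀ t₁))
    (hX₁c : ContinuousOn X₁ (Icc t₀ t₁)) (hH₀c : ContinuousOn H₀ (Icc t₀ t₁))
    (hH₁c : ContinuousOn H₁ (Icc t₀ t₁)) (hψc : ContinuousOn ψ (Icc t₀ t₁))
    (hD : X₁ t₀ + ∫ s in t₀..t₁, ((4 * G s + 3 * κ * σ₂ s) * X₁ s +
        4 * agmonConst ^ 4 * X₁ s ^ 3 / ν ^ 3 + 4 / ν * H₀ s + 3 * σ₂ s / κ * L s ^ 2) ≤ D)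
    (hΨ₂ : ∫ s in t₀..t₁, ψ s ≤ Ψ₂)
    (hsmall : agmonConst ^ 2 * μ / ν *
        Real.exp (∫ s in t₀..t₁, (6 * G s + 9 * κ * σ₂ s + 3 * κ ^ 2 * σ₃ s +
          3 * agmonConst ^ 2 * X₁ s / (ν * μ) + 27 * agmonConst ^ 4 * X₁ s ^ 2 / (16 * ν ^ 3))) *
      (2 * D / (ν * (t₁ - t₀)) + Ψ₂) * (t₁ - t₀) < 1)
    {t : ℝ} (ht : t ∈ Icc ((t₀ + t₁) / 2) t₁) :
    (∑ i, ∫ x, frobeniusNormSq (fderiv ℝ (fun y => fderiv ℝ ((v - u) t) y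
        (EuclideanSpace.basisFun (Fin 3) ℝ i)) x)) ≤
      Real.exp (∫ s in t₀..t, (6 * G s + 9 * κ * σ₂ s + 3 * κ ^ 2 * σ₃ s +
          3 * agmonConst ^ 2 * X₁ s / (ν * μ) + 27 * agmonConst ^ 4 * X₁ s ^ 2 / (16 * ν ^ 3))) *
          (2 * D / (ν * (t₁ - t₀)) + Ψ₂) /
        (1 - agmonConst ^ 2 * μ / ν *
          Real.exp (∫ s in t₀..t₁, (6 * G s + 9 * κ * σ₂ s + 3 * κ ^ 2 * σ₃ s +
            3 * agmonConst ^ 2 * X₁ s / (ν * μ) + 27 * agmonConst ^ 4 * X₁ s ^ 2 / (16 * ν ^ 3))) *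
          (2 * D / (ν * (t₁ - t₀)) + Ψ₂) * (t₁ - t₀)) := by
  have hT : 0 < t₁ - t₀ := sub_pos.2 ht₀₁
  -- the rate and the source density as single functions
  obtain ⟨l, hl⟩ : ∃ l : ℝ → ℝ, l = fun s => 6 * G s + 9 * κ * σ₂ s + 3 * κ ^ 2 * σ₃ s +
      3 * agmonConst ^ 2 * X₁ s / (ν * μ) + 27 * agmonConst ^ 4 * X₁ s ^ 2 / (16 * ν ^ 3) :=
    ⟨_, rfl⟩
  have hl' : ∀ s, 6 * G s + 9 * κ * σ₂ s + 3 * κ ^ 2 * σ₃ s +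
      3 * agmonConst ^ 2 * X₁ s / (ν * μ) + 27 * agmonConst ^ 4 * X₁ s ^ 2 / (16 * ν ^ 3) = l s :=
    fun s => by rw [hl]
  obtain ⟨φ, hφ⟩ : ∃ φ : ℝ → ℝ, φ = fun s => (4 * G s + 3 * κ * σ₂ s) * X₁ s +
      4 * agmonConst ^ 4 * X₁ s ^ 3 / ν ^ 3 + 4 / ν * H₀ s + 3 * σ₂ s / κ * L s ^ 2 := ⟨_, rfl⟩
  have hφ' : ∀ s, (4 * G s + 3 * κ * σ₂ s) * X₁ s +
      4 * agmonConst ^ 4 * X₁ s ^ 3 / ν ^ 3 + 4 / ν * H₀ s + 3 * σ₂ s / κ * L s ^ 2 = φ s :=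
    fun s => by rw [hφ]
  simp only [hl'] at hsmall ⊢
  simp only [hφ'] at hD
  -- the translated window `[0, t₁ − t₀]`
  have hpre : (fun s => s + t₀) ⁻¹' Icc t₀ t₁ = Icc 0 (t₁ - t₀) := by
    rw [Set.preimage_add_const_Icc, sub_self]
  have hmem : ∀ {s}, s ∈ Icc 0 (t₁ - t₀) → s + t₀ ∈ Icc t₀ t₁ := fun hs =>
    ⟨by linarith [hs.1], by linarith [hs.2]⟩
  have hmaps : MapsTo (fun s => s + t₀) (Icc 0 (t₁ - t₀)) (Icc t₀ t₁) := fun s hs => hmem hs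
  have hu' : IsClassicalNSSolutionOn (Icc 0 (t₁ - t₀)) ν (fun s => f (s + t₀)) (fun s => u (s + t₀))
      (fun s => p (s + t₀)) := by
    have h := hu.comp_add_right t₀
    rwa [hpre] at h
  have hv' : IsClassicalNSSolutionOn (Icc 0 (t₁ - t₀)) ν (fun s => g (s + t₀)) (fun s => v (s + t₀))
      (fun s => q (s + t₀)) := by
    have h := hv.comp_add_right t₀
    rwa [hpre] at h
  have hIcc : Icc t₀ t₁ = Icc (0 + t₀) (t₁ - t₀ + t₀) := by rw [zero_add, sub_add_cancel]
  have hU' : HasBoundedSobolevNormsOn (Icc 0 (t₁ - t₀)) (fun s => u (s + t₀)) := by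
    rw [hIcc] at hU
    exact h2s_bounds_comp_add hU
  have hV' : HasBoundedSobolevNormsOn (Icc 0 (t₁ - t₀)) (fun s => v (s + t₀)) := by
    rw [hIcc] at hV
    exact h2s_bounds_comp_add hV
  have hWeq : ∀ (w : ℝ → EuclideanSpace ℝ (Fin 3) → EuclideanSpace ℝ (Fin 3)),
      timeDerivWithin (Icc 0 (t₁ - t₀)) (fun s => w (s + t₀)) =
        fun s => timeDerivWithin (Icc t₀ t₁) w (s + t₀) := by
    intro w
    funext s x
    rw [← hpre]
    exact timeDerivWithin_comp_add_right (Icc t₀ t₁) w t₀ s x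
  have hUt' : HasBoundedSobolevNormsOn (Icc 0 (t₁ - t₀))
      (timeDerivWithin (Icc 0 (t₁ - t₀)) (fun s => u (s + t₀))) := by
    rw [hWeq u]
    have h2 : ∀ n : ℕ, ∃ C : ℝ≥0, ∀ s ∈ Icc (0 + t₀) (t₁ - t₀ + t₀),
        ∫⁻ x, ‖iteratedFDeriv ℝ n (timeDerivWithin (Icc t₀ t₁) u s) x‖ₑ ^ 2 ≤ C := by
      rw [← hIcc]; exact hUt
    exact h2s_bounds_comp_add h2
  have hVt' : HasBoundedSobolevNormsOn (Icc 0 (t₁ - t₀))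
      (timeDerivWithin (Icc 0 (t₁ - t₀)) (fun s => v (s + t₀))) := by
    rw [hWeq v]
    have h2 : ∀ n : ℕ, ∃ C : ℝ≥0, ∀ s ∈ Icc (0 + t₀) (t₁ - t₀ + t₀),
        ∫⁻ x, ‖iteratedFDeriv ℝ n (timeDerivWithin (Icc t₀ t₁) v s) x‖ₑ ^ 2 ≤ C := by
      rw [← hIcc]; exact hVt
    exact h2s_bounds_comp_add h2
  have hp' : ∀ n : ℕ, ∃ C : ℝ≥0, ∀ s ∈ Icc 0 (t₁ - t₀),
      ∫⁻ x, ‖iteratedFDeriv ℝ n (p (s + t₀)) x‖ₑ ^ 2 ≤ C := by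
    rw [hIcc] at hp
    exact h2s_bounds_comp_add hp
  have hq' : ∀ n : ℕ, ∃ C : ℝ≥0, ∀ s ∈ Icc 0 (t₁ - t₀),
      ∫⁻ x, ‖iteratedFDeriv ℝ n (q (s + t₀)) x‖ₑ ^ 2 ≤ C := by
    rw [hIcc] at hq
    exact h2s_bounds_comp_add hq
  have cadd : Continuous fun s : ℝ => s + t₀ := continuous_id.add continuous_const
  -- change of variables in the envelopes
  have eΛ : ∀ r, (∫ x in (0 : ℝ)..r, l (x + t₀)) = ∫ s in t₀..(r + t₀), l s := fun r => by
    rw [intervalIntegral.integral_comp_add_right l, zero_add]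
  have eΦ : (∫ x in (0 : ℝ)..(t₁ - t₀), φ (x + t₀)) = ∫ s in t₀..t₁, φ s := by
    rw [intervalIntegral.integral_comp_add_right φ, zero_add, sub_add_cancel]
  have eΨ : (∫ x in (0 : ℝ)..(t₁ - t₀), ψ (x + t₀)) = ∫ s in t₀..t₁, ψ s := by
    rw [intervalIntegral.integral_comp_add_right ψ, zero_add, sub_add_cancel]
  -- the translated slices at `t − t₀`
  have hr : t - t₀ ∈ Icc ((t₁ - t₀) / 2) (t₁ - t₀) :=
    ⟨by linarith [ht.1], sub_le_sub_right ht.2 _⟩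
  have e1 : ((fun s => v (s + t₀)) - fun s => u (s + t₀)) (t - t₀) = (v - u) t := by
    funext x
    simp only [Pi.sub_apply, sub_add_cancel]
  have esub : ∀ s, ((fun r => v (r + t₀)) - fun r => u (r + t₀)) s = (v - u) (s + t₀) := fun s => by
    funext x
    simp only [Pi.sub_apply]
  have key := classicalNS_H2_smoothing_strain_R3 hν hT hv' hu' hU' hUt' hp' hV' hVt' hq'
    (G := fun s => G (s + t₀)) (σ₂ := fun s => σ₂ (s + t₀)) (σ₃ := fun s => σ₃ (s + t₀))
    (L := fun s => L (s + t₀)) (X₁ := fun s => X₁ (s + t₀)) (H₀ := fun s => H₀ (s + t₀))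
    (H₁ := fun s => H₁ (s + t₀)) (ψ := fun s => ψ (s + t₀)) (D := D) (Ψ₂ := Ψ₂) hκ hμ
    (fun s hs => hG (s + t₀) (hmem hs)) (fun s hs => hσ₂ (s + t₀) (hmem hs))
    (fun s hs => hσ₃ (s + t₀) (hmem hs))
    (fun s hs => by rw [esub]; exact hL (s + t₀) (hmem hs))
    (fun s hs => by rw [esub]; exact hX₁ (s + t₀) (hmem hs))
    (fun s hs => hH₀ (s + t₀) (hmem hs)) (fun s hs => hH₁ (s + t₀) (hmem hs))
    (fun s hs => hψ (s + t₀) (hmem hs))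
    (hGc.comp cadd.continuousOn hmaps) (hσ₂c.comp cadd.continuousOn hmaps)
    (hσ₃c.comp cadd.continuousOn hmaps) (hLc.comp cadd.continuousOn hmaps)
    (hX₁c.comp cadd.continuousOn hmaps) (hH₀c.comp cadd.continuousOn hmaps)
    (hH₁c.comp cadd.continuousOn hmaps) (hψc.comp cadd.continuousOn hmaps)
    (by simp only [hφ', zero_add]; rw [eΦ]; exact hD) (by rw [eΨ]; exact hΨ₂)
    (by simp only [hl']; rw [eΛ, sub_add_cancel]; exact hsmall) hr
  rw [e1] at key
  simp only [hl', eΛ, sub_add_cancel] at key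
  exact key

/-- **Sup-norm distance on the second half of an arbitrary window from `H¹ / L²` data only**
(Agmon readout of `classicalNS_H2_smoothing_strain_window_R3`): for `t ∈ [(t₀ + t₁)/2, t₁]` and
every `x`, `‖v(t,x) − u(t,x)‖ ≤ A(3X₁(t)·e^{∫_{t₀}^{t} l}η/(1 − βe^{∫_{t₀}^{t₁} l}ηh))^{1/4}`.
[cite: RobinsonRodrigoSadowskiCUP2016, Thm 1.20; DashtiRobinson2008, Thm 2] -/
theorem classicalNS_norm_sub_le_H2_smoothing_window_R3 (hν : 0 < ν) (ht₀₁ : t₀ < t₁)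
    (hv : IsClassicalNSSolutionOn (Icc t₀ t₁) ν g v q)
    (hu : IsClassicalNSSolutionOn (Icc t₀ t₁) ν f u p)
    (hU : HasBoundedSobolevNormsOn (Icc t₀ t₁) u)
    (hUt : HasBoundedSobolevNormsOn (Icc t₀ t₁) (timeDerivWithin (Icc t₀ t₁) u))
    (hp : ∀ n : ℕ, ∃ C : ℝ≥0, ∀ t ∈ Icc t₀ t₁, ∫⁻ x, ‖iteratedFDeriv ℝ n (p t) x‖ₑ ^ 2 ≤ C)
    (hV : HasBoundedSobolevNormsOn (Icc t₀ t₁) v)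
    (hVt : HasBoundedSobolevNormsOn (Icc t₀ t₁) (timeDerivWithin (Icc t₀ t₁) v))
    (hq : ∀ n : ℕ, ∃ C : ℝ≥0, ∀ t ∈ Icc t₀ t₁, ∫⁻ x, ‖iteratedFDeriv ℝ n (q t) x‖ₑ ^ 2 ≤ C)
    {G σ₂ σ₃ L X₁ H₀ H₁ ψ : ℝ → ℝ} {κ μ D Ψ₂ : ℝ} (hκ : 0 < κ) (hμ : 0 < μ)
    (hG : ∀ s ∈ Icc t₀ t₁, ∀ (x ξ : EuclideanSpace ℝ (Fin 3)),
      -⟪fderiv ℝ (u s) x ξ, ξ⟫ ≤ G s * ‖ξ‖ ^ 2)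
    (hσ₂ : ∀ s ∈ Icc t₀ t₁, ∀ x, ‖iteratedFDeriv ℝ 2 (u s) x‖ ≤ σ₂ s)
    (hσ₃ : ∀ s ∈ Icc t₀ t₁, ∀ x, ‖iteratedFDeriv ℝ 3 (u s) x‖ ≤ σ₃ s)
    (hL : ∀ s ∈ Icc t₀ t₁, Real.sqrt (∫ x, ‖(v - u) s x‖ ^ 2) ≤ L s)
    (hX₁ : ∀ s ∈ Icc t₀ t₁, ∫ x, frobeniusNormSq (fderiv ℝ ((v - u) s) x) ≤ X₁ s)
    (hH₀ : ∀ s ∈ Icc t₀ t₁, ∫ x, ‖f s x - g s x‖ ^ 2 ≤ H₀ s)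
    (hH₁ : ∀ s ∈ Icc t₀ t₁, ∫ x, ‖fderiv ℝ (fun y => f s y - g s y) x‖ ^ 2 ≤ H₁ s)
    (hψ : ∀ s ∈ Icc t₀ t₁,
      27 * σ₂ s / κ * X₁ s + 9 * σ₃ s / κ ^ 2 * L s ^ 2 + 6 / ν * H₁ s ≤ ψ s)
    (hGc : ContinuousOn G (Icc t₀ t₁)) (hσ₂c : ContinuousOn σ₂ (Icc t₀ t₁))
    (hσ₃c : ContinuousOn σ₃ (Icc t₀ t₁)) (hLc : ContinuousOn L (Icc t₀ t₁))
    (hX₁c : ContinuousOn X₁ (Icc t₀ t₁)) (hH₀c : ContinuousOn H₀ (Icc t₀ t₁))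
    (hH₁c : ContinuousOn H₁ (Icc t₀ t₁)) (hψc : ContinuousOn ψ (Icc t₀ t₁))
    (hD : X₁ t₀ + ∫ s in t₀..t₁, ((4 * G s + 3 * κ * σ₂ s) * X₁ s +
        4 * agmonConst ^ 4 * X₁ s ^ 3 / ν ^ 3 + 4 / ν * H₀ s + 3 * σ₂ s / κ * L s ^ 2) ≤ D)
    (hΨ₂ : ∫ s in t₀..t₁, ψ s ≤ Ψ₂)
    (hsmall : agmonConst ^ 2 * μ / ν *
        Real.exp (∫ s in t₀..t₁, (6 * G s + 9 * κ * σ₂ s + 3 * κ ^ 2 * σ₃ s +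
          3 * agmonConst ^ 2 * X₁ s / (ν * μ) + 27 * agmonConst ^ 4 * X₁ s ^ 2 / (16 * ν ^ 3))) *
      (2 * D / (ν * (t₁ - t₀)) + Ψ₂) * (t₁ - t₀) < 1)
    {t : ℝ} (ht : t ∈ Icc ((t₀ + t₁) / 2) t₁) (x : EuclideanSpace ℝ (Fin 3)) :
    ‖v t x - u t x‖ ≤ agmonConst * (3 * X₁ t *
      (Real.exp (∫ s in t₀..t, (6 * G s + 9 * κ * σ₂ s + 3 * κ ^ 2 * σ₃ s +
          3 * agmonConst ^ 2 * X₁ s / (ν * μ) + 27 * agmonConst ^ 4 * X₁ s ^ 2 / (16 * ν ^ 3))) *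
          (2 * D / (ν * (t₁ - t₀)) + Ψ₂) /
        (1 - agmonConst ^ 2 * μ / ν *
          Real.exp (∫ s in t₀..t₁, (6 * G s + 9 * κ * σ₂ s + 3 * κ ^ 2 * σ₃ s +
            3 * agmonConst ^ 2 * X₁ s / (ν * μ) + 27 * agmonConst ^ 4 * X₁ s ^ 2 / (16 * ν ^ 3))) *
          (2 * D / (ν * (t₁ - t₀)) + Ψ₂) * (t₁ - t₀)))) ^ (1 / 4 : ℝ) := by
  have ht' : t ∈ Icc t₀ t₁ := ⟨le_trans (by linarith) ht.1, ht.2⟩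
  have hZ := classicalNS_H2_smoothing_strain_window_R3 hν ht₀₁ hv hu hU hUt hp hV hVt hq hκ hμ hG hσ₂
    hσ₃ hL hX₁ hH₀ hH₁ hψ hGc hσ₂c hσ₃c hLc hX₁c hH₀c hH₁c hψc hD hΨ₂ hsmall ht
  -- time-translate to `[0, t₁ − t₀]` to use the slice readout stated on `Icc 0 T`
  have hpre : (fun s => s + t₀) ⁻¹' Icc t₀ t₁ = Icc 0 (t₁ - t₀) := by
    rw [Set.preimage_add_const_Icc, sub_self]
  have hu' : IsClassicalNSSolutionOn (Icc 0 (t₁ - t₀)) ν (fun s => f (s + t₀)) (fun s => u (s + t₀))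
      (fun s => p (s + t₀)) := by
    have h := hu.comp_add_right t₀
    rwa [hpre] at h
  have hv' : IsClassicalNSSolutionOn (Icc 0 (t₁ - t₀)) ν (fun s => g (s + t₀)) (fun s => v (s + t₀))
      (fun s => q (s + t₀)) := by
    have h := hv.comp_add_right t₀
    rwa [hpre] at h
  have hIcc : Icc t₀ t₁ = Icc (0 + t₀) (t₁ - t₀ + t₀) := by rw [zero_add, sub_add_cancel]
  have hU' : HasBoundedSobolevNormsOn (Icc 0 (t₁ - t₀)) (fun s => u (s + t₀)) := by
    rw [hIcc] at hU
    exact h2s_bounds_comp_add hU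
  have hV' : HasBoundedSobolevNormsOn (Icc 0 (t₁ - t₀)) (fun s => v (s + t₀)) := by
    rw [hIcc] at hV
    exact h2s_bounds_comp_add hV
  have hr : t - t₀ ∈ Icc 0 (t₁ - t₀) := ⟨sub_nonneg.2 ht'.1, sub_le_sub_right ht'.2 _⟩
  have e1 : ((fun s => v (s + t₀)) - fun s => u (s + t₀)) (t - t₀) = (v - u) t := by
    funext y
    simp only [Pi.sub_apply, sub_add_cancel]
  have hX0 : 0 ≤ X₁ t := (integral_nonneg fun y => frobeniusNormSq_nonneg _).trans (hX₁ t ht')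
  have h := classicalNS_norm_sub_le_of_H1_H2_R3 hv' hu' hU' hV' hr
    (X₁ := X₁ t) (by rw [e1]; exact hX₁ t ht') le_rfl x
  rw [e1] at h
  simp only [sub_add_cancel] at h
  refine h.trans (mul_le_mul_of_nonneg_left (Real.rpow_le_rpow ?_ ?_ (by norm_num)) agmonConst_nonneg)
  · exact mul_nonneg (mul_nonneg (by norm_num) hX0)
      (Finset.sum_nonneg fun i _ => integral_nonneg fun y => frobeniusNormSq_nonneg _)
  · exact mul_le_mul_of_nonneg_left hZ (mul_nonneg (by norm_num) hX0)

/-- **Closed form under half-smallness** (the readable price): in the setting of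
`classicalNS_H2_smoothing_strain_window_R3`, if `βe^{∫_{t₀}^{t₁} l}ηh ≤ 1/2` then
`Σᵢ∫|∇∂ᵢ(v − u)(t)|²_F ≤ 2e^{∫_{t₀}^{t} l}η` on `[(t₀ + t₁)/2, t₁]` (`η = 2D/(νh) + Ψ₂`): fee
`e^{∫l}` over ONE window, the `H¹` budget `D` weighted by `2/(νh)`.
[cite: ConstantinFoias1988, Ch. 10 (proof of Thm 10.6); DashtiRobinson2008, Thm 2] -/
theorem classicalNS_H2_smoothing_strain_window_half_R3 (hν : 0 < ν) (ht₀₁ : t₀ < t₁)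
    (hv : IsClassicalNSSolutionOn (Icc t₀ t₁) ν g v q)
    (hu : IsClassicalNSSolutionOn (Icc t₀ t₁) ν f u p)
    (hU : HasBoundedSobolevNormsOn (Icc t₀ t₁) u)
    (hUt : HasBoundedSobolevNormsOn (Icc t₀ t₁) (timeDerivWithin (Icc t₀ t₁) u))
    (hp : ∀ n : ℕ, ∃ C : ℝ≥0, ∀ t ∈ Icc t₀ t₁, ∫⁻ x, ‖iteratedFDeriv ℝ n (p t) x‖ₑ ^ 2 ≤ C)
    (hV : HasBoundedSobolevNormsOn (Icc t₀ t₁) v)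
    (hVt : HasBoundedSobolevNormsOn (Icc t₀ t₁) (timeDerivWithin (Icc t₀ t₁) v))
    (hq : ∀ n : ℕ, ∃ C : ℝ≥0, ∀ t ∈ Icc t₀ t₁, ∫⁻ x, ‖iteratedFDeriv ℝ n (q t) x‖ₑ ^ 2 ≤ C)
    {G σ₂ σ₃ L X₁ H₀ H₁ ψ : ℝ → ℝ} {κ μ D Ψ₂ : ℝ} (hκ : 0 < κ) (hμ : 0 < μ)
    (hG : ∀ s ∈ Icc t₀ t₁, ∀ (x ξ : EuclideanSpace ℝ (Fin 3)),
      -⟪fderiv ℝ (u s) x ξ, ξ⟫ ≤ G s * ‖ξ‖ ^ 2)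
    (hσ₂ : ∀ s ∈ Icc t₀ t₁, ∀ x, ‖iteratedFDeriv ℝ 2 (u s) x‖ ≤ σ₂ s)
    (hσ₃ : ∀ s ∈ Icc t₀ t₁, ∀ x, ‖iteratedFDeriv ℝ 3 (u s) x‖ ≤ σ₃ s)
    (hL : ∀ s ∈ Icc t₀ t₁, Real.sqrt (∫ x, ‖(v - u) s x‖ ^ 2) ≤ L s)
    (hX₁ : ∀ s ∈ Icc t₀ t₁, ∫ x, frobeniusNormSq (fderiv ℝ ((v - u) s) x) ≤ X₁ s)
    (hH₀ : ∀ s ∈ Icc t₀ t₁, ∫ x, ‖f s x - g s x‖ ^ 2 ≤ H₀ s)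
    (hH₁ : ∀ s ∈ Icc t₀ t₁, ∫ x, ‖fderiv ℝ (fun y => f s y - g s y) x‖ ^ 2 ≤ H₁ s)
    (hψ : ∀ s ∈ Icc t₀ t₁,
      27 * σ₂ s / κ * X₁ s + 9 * σ₃ s / κ ^ 2 * L s ^ 2 + 6 / ν * H₁ s ≤ ψ s)
    (hGc : ContinuousOn G (Icc t₀ t₁)) (hσ₂c : ContinuousOn σ₂ (Icc t₀ t₁))
    (hσ₃c : ContinuousOn σ₃ (Icc t₀ t₁)) (hLc : ContinuousOn L (Icc t₀ t₁))
    (hX₁c : ContinuousOn X₁ (Icc t₀ t₁)) (hH₀c : ContinuousOn H₀ (Icc t₀ t₁))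
    (hH₁c : ContinuousOn H₁ (Icc t₀ t₁)) (hψc : ContinuousOn ψ (Icc t₀ t₁))
    (hD : X₁ t₀ + ∫ s in t₀..t₁, ((4 * G s + 3 * κ * σ₂ s) * X₁ s +
        4 * agmonConst ^ 4 * X₁ s ^ 3 / ν ^ 3 + 4 / ν * H₀ s + 3 * σ₂ s / κ * L s ^ 2) ≤ D)
    (hΨ₂ : ∫ s in t₀..t₁, ψ s ≤ Ψ₂)
    (hhalf : agmonConst ^ 2 * μ / ν *
        Real.exp (∫ s in t₀..t₁, (6 * G s + 9 * κ * σ₂ s + 3 * κ ^ 2 * σ₃ s +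
          3 * agmonConst ^ 2 * X₁ s / (ν * μ) + 27 * agmonConst ^ 4 * X₁ s ^ 2 / (16 * ν ^ 3))) *
      (2 * D / (ν * (t₁ - t₀)) + Ψ₂) * (t₁ - t₀) ≤ 1 / 2)
    {t : ℝ} (ht : t ∈ Icc ((t₀ + t₁) / 2) t₁) :
    (∑ i, ∫ x, frobeniusNormSq (fderiv ℝ (fun y => fderiv ℝ ((v - u) t) y
        (EuclideanSpace.basisFun (Fin 3) ℝ i)) x)) ≤
      2 * Real.exp (∫ s in t₀..t, (6 * G s + 9 * κ * σ₂ s + 3 * κ ^ 2 * σ₃ s +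
          3 * agmonConst ^ 2 * X₁ s / (ν * μ) + 27 * agmonConst ^ 4 * X₁ s ^ 2 / (16 * ν ^ 3))) *
        (2 * D / (ν * (t₁ - t₀)) + Ψ₂) := by
  have key := classicalNS_H2_smoothing_strain_window_R3 hν ht₀₁ hv hu hU hUt hp hV hVt hq hκ hμ hG hσ₂
    hσ₃ hL hX₁ hH₀ hH₁ hψ hGc hσ₂c hσ₃c hLc hX₁c hH₀c hH₁c hψc hD hΨ₂ (lt_of_le_of_lt hhalf (by norm_num)) ht
  refine key.trans ?_
  -- `e η / (1 − c) ≤ 2 e η` for `c ≤ 1/2`, `e η ≥ 0`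
  have ht' : t ∈ Icc t₀ t₁ := ⟨le_trans (by linarith) ht.1, ht.2⟩
  have hσ₂0 : ∀ s ∈ Icc t₀ t₁, 0 ≤ σ₂ s := fun s hs => (norm_nonneg _).trans (hσ₂ s hs 0)
  have hσ₃0 : ∀ s ∈ Icc t₀ t₁, 0 ≤ σ₃ s := fun s hs => (norm_nonneg _).trans (hσ₃ s hs 0)
  have hX₁0 : ∀ s ∈ Icc t₀ t₁, 0 ≤ X₁ s := fun s hs =>
    (integral_nonneg fun x => frobeniusNormSq_nonneg _).trans (hX₁ s hs)
  have hH₁0 : ∀ s ∈ Icc t₀ t₁, 0 ≤ H₁ s := fun s hs =>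
    (integral_nonneg fun x => sq_nonneg _).trans (hH₁ s hs)
  have hψ0 : ∀ s ∈ Icc t₀ t₁, 0 ≤ ψ s := fun s hs => by
    refine le_trans ?_ (hψ s hs)
    have := hσ₂0 s hs; have := hσ₃0 s hs; have := hX₁0 s hs; have := hH₁0 s hs
    positivity
  have hG0 : ∀ s ∈ Icc t₀ t₁, 0 ≤ G s := fun s hs => by
    -- trace of `Du` vanishes (`div u = 0`)
    have hd := hu.divFree s hs 0
    rw [divergence_eq_sum_inner_fderiv (EuclideanSpace.basisFun (Fin 3) ℝ), Fin.sum_univ_three] at hd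
    have he : ∀ i, ‖EuclideanSpace.basisFun (Fin 3) ℝ i‖ = 1 := fun i => by simp
    have h0 := hG s hs 0 (EuclideanSpace.basisFun (Fin 3) ℝ 0)
    have h1 := hG s hs 0 (EuclideanSpace.basisFun (Fin 3) ℝ 1)
    have h2 := hG s hs 0 (EuclideanSpace.basisFun (Fin 3) ℝ 2)
    rw [he, one_pow, mul_one, real_inner_comm] at h0 h1 h2
    linarith
  have hH₀0 : ∀ s ∈ Icc t₀ t₁, 0 ≤ H₀ s := fun s hs =>
    (integral_nonneg fun x => sq_nonneg _).trans (hH₀ s hs)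
  have hφ0 : ∀ s ∈ Icc t₀ t₁, 0 ≤ (4 * G s + 3 * κ * σ₂ s) * X₁ s +
      4 * agmonConst ^ 4 * X₁ s ^ 3 / ν ^ 3 + 4 / ν * H₀ s + 3 * σ₂ s / κ * L s ^ 2 := fun s hs => by
    have := hG0 s hs; have := hσ₂0 s hs; have := hX₁0 s hs; have := hH₀0 s hs
    have := agmonConst_nonneg
    positivity
  have hD0 : 0 ≤ D := le_trans (add_nonneg (hX₁0 t₀ ⟨le_rfl, ht₀₁.le⟩)
    (intervalIntegral.integral_nonneg ht₀₁.le hφ0)) hD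
  have hΨ₂0 : 0 ≤ Ψ₂ := (intervalIntegral.integral_nonneg ht₀₁.le hψ0).trans hΨ₂
  have hT : 0 < t₁ - t₀ := sub_pos.2 ht₀₁
  have hη0 : 0 ≤ 2 * D / (ν * (t₁ - t₀)) + Ψ₂ := by positivity
  generalize (2 * D / (ν * (t₁ - t₀)) + Ψ₂) = η at hhalf hη0 ⊢
  generalize (Real.exp (∫ s in t₀..t₁, (6 * G s + 9 * κ * σ₂ s + 3 * κ ^ 2 * σ₃ s +
          3 * agmonConst ^ 2 * X₁ s / (ν * μ) + 27 * agmonConst ^ 4 * X₁ s ^ 2 / (16 * ν ^ 3)))) =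
    E₁ at hhalf ⊢
  have hEt := Real.exp_pos (∫ s in t₀..t, (6 * G s + 9 * κ * σ₂ s + 3 * κ ^ 2 * σ₃ s +
          3 * agmonConst ^ 2 * X₁ s / (ν * μ) + 27 * agmonConst ^ 4 * X₁ s ^ 2 / (16 * ν ^ 3)))
  generalize (Real.exp (∫ s in t₀..t, (6 * G s + 9 * κ * σ₂ s + 3 * κ ^ 2 * σ₃ s +
          3 * agmonConst ^ 2 * X₁ s / (ν * μ) + 27 * agmonConst ^ 4 * X₁ s ^ 2 / (16 * ν ^ 3)))) =
    Et at hEt ⊢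
  have hden : (1 : ℝ) / 2 ≤ 1 - agmonConst ^ 2 * μ / ν * E₁ * η * (t₁ - t₀) := by linarith
  rw [div_le_iff₀ (lt_of_lt_of_le (by norm_num) hden)]
  have hEη : 0 ≤ Et * η := mul_nonneg hEt.le hη0
  nlinarith

end WindowSmoothing

end Literature.Analysis.FluidPDE
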